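/-
Copyright: H21 programme, solo seat `solo-RiemannHypothesis-informed` (session 5).
-/
import Summits.RiemannHypothesis.RiemannHypothesis.Theorems.SoloInformedEffDoubleLog

/-!
# Local visibility with a finite exception set (solo-informed, T12/T13 for clusters)

`SoloInformedEffThreshold` (T12/T13, effective) bounds the Weil ground-state energy `ε(a)` from
above by the local sampling majorant of an odd dipole minus the gain of an off-line pair
`ρ₀, ρ₁ = ½ ± η + iγ₀`, under the local hypothesis that every OTHER zero with `|Im ρ − γ₀| < R`
is on the critical line.  Here the local hypothesis exempts, besides the pair, an arbitrary finite
set `S'` on which the `γ₀`-twisted transform of the test VANISHES; the `S'`-terms then drop out of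
the sampling energy (`weilSamplingEnergy_le_local_eff` with `S = {ρ₀, ρ₁} ∪ (S' ∖ {1})`) and the
conclusion is literally that of T12/T13:

* `weilGroundEnergy_le_local_of_oddTest_cluster` (T12 for clusters);
* `weilGroundEnergy_neg_of_local_oddTest_cluster` (T13 for clusters, threshold form).

The test `k` is any odd Weil test here (no dodge structure is assumed); the cluster dodge that
produces the vanishing is built in `SoloInformedClusterDodge` (T25).
-/

open MeasureTheory Complex Set Filter Topology Literature.NumberTheory.LFunctions
open scoped ContDiff ComplexConjugate

namespace Summit.RiemannHypothesis.RiemannHypothesis.Theorems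

/-! ## T12/T13 for clusters: an odd test whose twisted transform vanishes on the cluster -/

/-- **T12 for clusters.**  Local upper bound for the ground-state defect tested against an odd
test `k` on `[−a, a]` whose `γ₀`-twisted transform vanishes on a finite set `S'`, the local
hypothesis exempting the pair `½ ± η + iγ₀` and `S'`. -/
theorem weilGroundEnergy_le_local_of_oddTest_cluster :
    ∀ (k : ℝ → ℂ) (a η γ₀ R : ℝ) (n : ℕ) (S' : Finset ℂ), IsWeilTest k →
      (∀ t, k (-t) = -k t) → 0 ≤ a → 1 ≤ R → tsupport k ⊆ Icc (-a) a →
      0 < ∫ t, ‖k t‖ ^ 2 → riemannZeta (1 / 2 + η + γ₀ * I) = 0 → |η| < 1 / 2 →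
      η ≠ 0 → γ₀ ≠ 0 →
      (∀ ρ ∈ S', weilMellin (fun t ↦ k t * cexp (-(γ₀ * I) * t)) ρ = 0) →
      (∀ ρ : ℂ, riemannZeta ρ = 0 → 0 ≤ ρ.re → ρ.re ≤ 1 → |ρ.im - γ₀| < R → ρ.re ≠ 1 / 2 →
          ρ = 1 / 2 + η + γ₀ * I ∨ ρ = 1 / 2 - η + γ₀ * I ∨ ρ ∈ S') →
        weilGroundEnergy a ≤
          (2 * zetaDensityConst * (((∫ t : ℝ, ‖k t‖) ^ 2 + (∫ t : ℝ, ‖deriv k t‖) ^ 2)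
                + 2 * Real.exp a * (∫ t : ℝ, ‖iteratedDeriv (n + 1) k t‖) ^ 2 / R ^ (2 * n))
              * Real.log (|γ₀| + 2)
            - 2 * ((riemannZetaZeroOrder (1 / 2 + η + γ₀ * I) : ℝ)
                * ‖∫ t : ℝ, k t * cexp ((η : ℂ) * t)‖ ^ 2))
            / ∫ t, ‖k t‖ ^ 2 := by
  intro k a η γ₀ R n S' hk hodd ha hR hks hpos hζ hη hη0 hγ hvan hloc
  have hS := weilSamplingEnergy_le_local_eff
  classical
  set ρ₀ : ℂ := 1 / 2 + η + γ₀ * I with hρ₀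
  set ρ₁ : ℂ := 1 / 2 - η + γ₀ * I with hρ₁
  set G : ℝ := ‖∫ t : ℝ, k t * cexp ((η : ℂ) * t)‖ ^ 2 with hG
  have hne : ρ₀ ≠ ρ₁ := by
    intro h01
    have := congrArg Complex.re h01
    simp [hρ₀, hρ₁] at this
    exact hη0 (by linarith)
  have hρ₀1 : ρ₀ ≠ 1 := by
    intro h1
    have := congrArg Complex.im h1
    simp [hρ₀] at this
    exact hγ this
  have hρ₁1 : ρ₁ ≠ 1 := by
    intro h1
    have := congrArg Complex.im h1
    simp [hρ₁] at this
    exact hγ this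
  have hP1 : ∀ ρ ∈ ({ρ₀, ρ₁} : Finset ℂ), ρ ≠ 1 := by
    intro ρ hρ
    rcases Finset.mem_insert.mp hρ with h0 | h1
    · rw [h0]; exact hρ₀1
    · rw [Finset.mem_singleton.mp h1]; exact hρ₁1
  have hS1 : ∀ ρ ∈ ({ρ₀, ρ₁} ∪ S'.erase 1 : Finset ℂ), ρ ≠ 1 := by
    intro ρ hρ
    rcases Finset.mem_union.mp hρ with hp | hs
    · exact hP1 ρ hp
    · exact (Finset.mem_erase.mp hs).1
  have hloc' : ∀ ρ : ℂ, riemannZeta ρ = 0 → 0 ≤ ρ.re → ρ.re ≤ 1 → |ρ.im - γ₀| < R →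
      ρ ∉ ({ρ₀, ρ₁} ∪ S'.erase 1 : Finset ℂ) → ρ.re = 1 / 2 := by
    intro ρ hz h0 h1 hnear hρS
    by_contra hre
    have hρ1 : ρ ≠ 1 := by rintro rfl; exact riemannZeta_one_ne_zero hz
    rcases hloc ρ hz h0 h1 hnear hre with h | h | h
    · exact hρS (Finset.mem_union_left _ (by rw [h]; simp))
    · exact hρS (Finset.mem_union_left _ (by rw [h]; simp))
    · exact hρS (Finset.mem_union_right _ (Finset.mem_erase.mpr ⟨hρ1, h⟩))
  have hB := hS k a γ₀ R n ({ρ₀, ρ₁} ∪ S'.erase 1) hk ha hR hks hS1 hloc'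
  -- the two exceptional values
  have e1 : ∀ (f : ℝ → ℂ) (c : ℝ), ∫ t : ℝ, f t * cexp ((c : ℂ) * t) =
      weilMellin f (1 / 2 + c) := by
    intro f c; unfold weilMellin; congr 1 with t; congr 2; ring
  have hval : ∀ c : ℝ, ‖weilMellin (fun t ↦ k t * cexp (-(γ₀ * I) * t)) (1 / 2 + c + γ₀ * I)‖ ^ 2
      = ‖∫ t : ℝ, k t * cexp ((c : ℂ) * t)‖ ^ 2 := by
    intro c
    rw [weilMellin_mul_cexp]
    have e0 : (1 / 2 + (c : ℂ) + γ₀ * I + -(γ₀ * I)) = 1 / 2 + c := by ring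
    rw [e0, e1]
  have hval0 : ‖weilMellin (fun t ↦ k t * cexp (-(γ₀ * I) * t)) ρ₀‖ ^ 2 = G := by
    rw [hρ₀, hval η]
  have hval1 : ‖weilMellin (fun t ↦ k t * cexp (-(γ₀ * I) * t)) ρ₁‖ ^ 2 = G := by
    have e : ρ₁ = 1 / 2 + ((-η : ℝ) : ℂ) + γ₀ * I := by rw [hρ₁]; push_cast; ring
    rw [e, hval (-η), hG]
    have hint : ∫ t : ℝ, k t * cexp (((-η : ℝ) : ℂ) * t) =
        -∫ t : ℝ, k t * cexp ((η : ℂ) * t) := by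
      rw [← integral_odd_mul_cexp_neg hodd η]
      congr 1 with t; push_cast; ring_nf
    rw [hint, norm_neg]
  have hm1 : (riemannZetaZeroOrder ρ₁ : ℝ) = riemannZetaZeroOrder ρ₀ := by
    have e : ρ₁ = conj (1 - ρ₀) := by
      apply Complex.ext
      · simp [hρ₀, hρ₁]; ring
      · simp [hρ₀, hρ₁]
    have h0 : 0 < ρ₀.re := by
      have := (abs_lt.mp hη).1
      simp [hρ₀]; linarith
    have h1 : ρ₀.re < 1 := by
      have := (abs_lt.mp hη).2
      simp [hρ₀]; linarith
    rw [e, riemannZetaZeroOrder_conj_holds (1 - ρ₀), riemannZetaZeroOrder_one_sub_holds h0 h1]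
  have hsumP : ∑ ρ ∈ ({ρ₀, ρ₁} : Finset ℂ), (riemannZetaZeroOrder ρ : ℝ) *
      ‖weilMellin (fun t ↦ k t * cexp (-(γ₀ * I) * t)) ρ‖ ^ 2 =
      2 * ((riemannZetaZeroOrder ρ₀ : ℝ) * G) := by
    rw [Finset.sum_pair hne, hval0, hval1, hm1]
    ring
  -- the sum over the cluster vanishes
  have hsum : ∑ ρ ∈ ({ρ₀, ρ₁} ∪ S'.erase 1 : Finset ℂ), (riemannZetaZeroOrder ρ : ℝ) *
      ‖weilMellin (fun t ↦ k t * cexp (-(γ₀ * I) * t)) ρ‖ ^ 2 =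
      2 * ((riemannZetaZeroOrder ρ₀ : ℝ) * G) := by
    rw [← hsumP]
    symm
    refine Finset.sum_subset Finset.subset_union_left fun ρ hρS hρP ↦ ?_
    rcases Finset.mem_union.mp hρS with hp | hs
    · exact absurd hp hρP
    · rw [hvan ρ (Finset.mem_of_mem_erase hs), norm_zero]
      ring
  simp_rw [hsum] at hB
  have key := weilGroundEnergy_le_of_oddDipole hk hodd hks hpos hζ hη.le hγ hB
  refine key.trans_eq ?_
  congr 1
  ring

/-- **T13 for clusters.**  Threshold form: if the local sampling majorant is beaten by the pair
gain `2·m(ρ₀)·|∫ k e^{ηt}|²`, then `ε(a) < 0`. -/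
theorem weilGroundEnergy_neg_of_local_oddTest_cluster :
    ∀ (k : ℝ → ℂ) (a η γ₀ R : ℝ) (n : ℕ) (S' : Finset ℂ), IsWeilTest k →
      (∀ t, k (-t) = -k t) → 0 ≤ a → 1 ≤ R → tsupport k ⊆ Icc (-a) a →
      0 < ∫ t, ‖k t‖ ^ 2 → riemannZeta (1 / 2 + η + γ₀ * I) = 0 → |η| < 1 / 2 →
      η ≠ 0 → γ₀ ≠ 0 →
      (∀ ρ ∈ S', weilMellin (fun t ↦ k t * cexp (-(γ₀ * I) * t)) ρ = 0) →
      (∀ ρ : ℂ, riemannZeta ρ = 0 → 0 ≤ ρ.re → ρ.re ≤ 1 → |ρ.im - γ₀| < R → ρ.re ≠ 1 / 2 →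
          ρ = 1 / 2 + η + γ₀ * I ∨ ρ = 1 / 2 - η + γ₀ * I ∨ ρ ∈ S') →
      2 * zetaDensityConst * (((∫ t : ℝ, ‖k t‖) ^ 2 + (∫ t : ℝ, ‖deriv k t‖) ^ 2)
            + 2 * Real.exp a * (∫ t : ℝ, ‖iteratedDeriv (n + 1) k t‖) ^ 2 / R ^ (2 * n))
          * Real.log (|γ₀| + 2)
        < 2 * ((riemannZetaZeroOrder (1 / 2 + η + γ₀ * I) : ℝ)
            * ‖∫ t : ℝ, k t * cexp ((η : ℂ) * t)‖ ^ 2) →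
        weilGroundEnergy a < 0 := by
  intro k a η γ₀ R n S' hk hodd ha hR hks hpos hζ hη hη0 hγ hvan hloc hwin
  have key := weilGroundEnergy_le_local_of_oddTest_cluster k a η γ₀ R n S' hk hodd ha hR hks
    hpos hζ hη hη0 hγ hvan hloc
  exact key.trans_lt (div_neg_of_neg_of_pos (by linarith) hpos)

end Summit.RiemannHypothesis.RiemannHypothesis.Theorems
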